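import Mathlib
import Literature.Probability.LatticeModels.TorusTransferSpectral
import HarnessLib

/-!
# Elementary estimates for the cycle momenta `2πk/L`

Topic `Probability/LatticeModels`. Small real-variable lemmas about the dispersion
`1 - cos(2πk/L)` of the cycle `ℤ/Lℤ` and the associated exponential sums, used by the transverse
evaluation of four-dimensional torus kernels (`MaxwellKernelTransverse.lean`,
`MaxwellKernelBand.lean`). PROVED here:

* `eight_mul_sq_div_sq_le_one_sub_cos`, `eight_mul_sq_div_sq_le_one_sub_cos'`,
  `eight_div_sq_le_one_sub_cos` — Jordan's inequality on the two half-periods: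
  `1 - cos(2πj/L) ≥ 8 min(j, L-j)²/L²`, in particular `≥ 8/L²` off the zero mode;
* `cycle_sum_exp_neg_sqrt_le`, `cycle_sum_sqrt_mul_exp_le` — the exponential sums
  `∑_k e^{-β√(1 - cos(2πk/L))} ≤ 2 + L/β` and `∑_k x_k e^{-βx_k} ≤ (2/β)(2 + 2L/β)`
  (`x_k = √(1 - cos(2πk/L))`), by comparison with two geometric series;
* `one_div_one_sub_exp_neg_le`, `one_div_one_add_le_exp_neg`, `sum_sq_le_sq_sum`,
  `cube_le_three_mul_sum_sq`, `prod_ite_eq_fin_three` — bookkeeping inequalities.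

All statements are folklore calculus. Mathlib anchors: `Real.cos_le_one_sub_mul_cos_sq` (Jordan),
`geom_sum_Ico_le_of_lt_one`, `Real.exp_bound_div_one_sub_of_interval`, `Real.add_one_le_exp`;
the tree's `sum_zmod_val_eq_sum_range` (`TorusTransferSpectral.lean`).
-/

noncomputable section

open Finset Real

namespace Literature.Probability.LatticeModels

section CycleEstimates

variable {L : ℕ} [NeZero L]

/-- Jordan's inequality on the cycle, first half-period: `8 j²/L² ≤ 1 - cos(2πj/L)` for
`2j ≤ L`. [folklore] -/
theorem eight_mul_sq_div_sq_le_one_sub_cos {j : ℕ} (hj : 2 * j ≤ L) :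
    8 * (j : ℝ) ^ 2 / (L : ℝ) ^ 2 ≤ 1 - Real.cos (2 * π * (j : ℝ) / L) := by
  have hL : (0 : ℝ) < L := by exact_mod_cast Nat.pos_of_ne_zero (NeZero.ne L)
  have hθ : |2 * π * (j : ℝ) / L| ≤ π := by
    rw [abs_of_nonneg (by positivity), div_le_iff₀ hL]
    have : (2 * j : ℝ) ≤ L := by exact_mod_cast hj
    nlinarith [Real.pi_pos]
  have h := Real.cos_le_one_sub_mul_cos_sq hθ
  have e : 2 / π ^ 2 * (2 * π * (j : ℝ) / L) ^ 2 = 8 * (j : ℝ) ^ 2 / (L : ℝ) ^ 2 := by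
    field_simp
    ring
  linarith

/-- Jordan's inequality on the cycle, second half-period: `8 (L-j)²/L² ≤ 1 - cos(2πj/L)` for
`L ≤ 2j ≤ 2L`. [folklore] -/
theorem eight_mul_sq_div_sq_le_one_sub_cos' {j : ℕ} (hjL : j ≤ L) (hj : L ≤ 2 * j) :
    8 * ((L - j : ℕ) : ℝ) ^ 2 / (L : ℝ) ^ 2 ≤ 1 - Real.cos (2 * π * (j : ℝ) / L) := by
  have hL : (0 : ℝ) < L := by exact_mod_cast Nat.pos_of_ne_zero (NeZero.ne L)
  have h := eight_mul_sq_div_sq_le_one_sub_cos (L := L) (j := L - j) (by omega)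
  have e : Real.cos (2 * π * ((L - j : ℕ) : ℝ) / L) = Real.cos (2 * π * (j : ℝ) / L) := by
    rw [Nat.cast_sub hjL]
    have : 2 * π * ((L : ℝ) - j) / L = -(2 * π * (j : ℝ) / L) + 2 * π := by
      field_simp
      ring
    rw [this, Real.cos_add_two_pi, Real.cos_neg]
  rwa [e] at h

/-- Off the zero mode the cycle dispersion is at least `8/L²`:
`8/L² ≤ 1 - cos(2πy/L)` for `y ≠ 0` in `ℤ/Lℤ`. [folklore] -/
theorem eight_div_sq_le_one_sub_cos {y : ZMod L} (hy : y ≠ 0) :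
    8 / (L : ℝ) ^ 2 ≤ 1 - Real.cos (2 * π * (y.val : ℝ) / L) := by
  have hv0 : y.val ≠ 0 := (ZMod.val_ne_zero y).2 hy
  have hvL : y.val < L := ZMod.val_lt y
  have hL : (0 : ℝ) < (L : ℝ) ^ 2 := by
    have : (0 : ℝ) < L := by exact_mod_cast Nat.pos_of_ne_zero (NeZero.ne L)
    positivity
  rcases le_or_gt (2 * y.val) L with h | h
  · refine le_trans ?_ (eight_mul_sq_div_sq_le_one_sub_cos h)
    rw [div_le_div_iff_of_pos_right hL]
    have : (1 : ℝ) ≤ y.val := by exact_mod_cast Nat.one_le_iff_ne_zero.2 hv0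
    nlinarith
  · refine le_trans ?_ (eight_mul_sq_div_sq_le_one_sub_cos' hvL.le h.le)
    rw [div_le_div_iff_of_pos_right hL]
    have : (1 : ℝ) ≤ ((L - y.val : ℕ) : ℝ) := by exact_mod_cast (show 1 ≤ L - y.val by omega)
    nlinarith

/-- Pointwise: `exp(-β √(1 - cos(2πj/L))) ≤ r^j + r^{L-j}` with `r = exp(-2β/L)`, `j < L`
(Jordan on the two half-periods). [folklore] -/
theorem exp_neg_mul_sqrt_one_sub_cos_le {β : ℝ} (hβ : 0 ≤ β) {j : ℕ} (hj : j < L) :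
    Real.exp (-(β * Real.sqrt (1 - Real.cos (2 * π * (j : ℝ) / L)))) ≤
      Real.exp (-(2 * β / L)) ^ j + Real.exp (-(2 * β / L)) ^ (L - j) := by
  have hL : (0 : ℝ) < L := by exact_mod_cast Nat.pos_of_ne_zero (NeZero.ne L)
  have hr : ∀ m : ℕ, Real.exp (-(2 * β / L)) ^ m = Real.exp (-(β * (2 * (m : ℝ) / L))) := fun m => by
    rw [← Real.exp_nat_mul]
    ring_nf
  have hr0 : ∀ m : ℕ, 0 ≤ Real.exp (-(2 * β / L)) ^ m := fun m => pow_nonneg (Real.exp_nonneg _) m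
  have key : ∀ x : ℝ, 0 ≤ x → 8 * x ^ 2 / (L : ℝ) ^ 2 ≤ 1 - Real.cos (2 * π * (j : ℝ) / L) →
      Real.exp (-(β * Real.sqrt (1 - Real.cos (2 * π * (j : ℝ) / L)))) ≤
        Real.exp (-(β * (2 * x / L))) := by
    intro x hx h8
    rw [Real.exp_le_exp, neg_le_neg_iff]
    refine mul_le_mul_of_nonneg_left ?_ hβ
    have hsq : (2 * x / L) ^ 2 ≤ 1 - Real.cos (2 * π * (j : ℝ) / L) := by
      refine le_trans ?_ h8
      have : (2 * x / L) ^ 2 = 4 * x ^ 2 / (L : ℝ) ^ 2 := by ring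
      rw [this]
      gcongr
      norm_num
    calc 2 * x / L = Real.sqrt ((2 * x / L) ^ 2) := (Real.sqrt_sq (by positivity)).symm
      _ ≤ _ := Real.sqrt_le_sqrt hsq
  rcases le_or_gt (2 * j) L with h | h
  · calc _ ≤ Real.exp (-(β * (2 * (j : ℝ) / L))) :=
          key j (Nat.cast_nonneg j) (eight_mul_sq_div_sq_le_one_sub_cos h)
      _ = Real.exp (-(2 * β / L)) ^ j := (hr j).symm
      _ ≤ _ := le_add_of_nonneg_right (hr0 _)
  · calc _ ≤ Real.exp (-(β * (2 * ((L - j : ℕ) : ℝ) / L))) :=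
          key _ (Nat.cast_nonneg _) (eight_mul_sq_div_sq_le_one_sub_cos' hj.le h.le)
      _ = Real.exp (-(2 * β / L)) ^ (L - j) := (hr (L - j)).symm
      _ ≤ _ := le_add_of_nonneg_left (hr0 _)

/-- `1/(1 - e^{-u}) ≤ 1 + 1/u` for `u > 0` (from `1 + u ≤ eᵘ`). [folklore] -/
theorem one_div_one_sub_exp_neg_le {u : ℝ} (hu : 0 < u) :
    1 / (1 - Real.exp (-u)) ≤ 1 + 1 / u := by
  have hr_le : Real.exp (-u) ≤ 1 / (1 + u) := by
    rw [Real.exp_neg, one_div]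
    exact inv_anti₀ (by positivity) (by linarith [Real.add_one_le_exp u])
  have h1r : u / (1 + u) ≤ 1 - Real.exp (-u) := by
    have : 1 - 1 / (1 + u) = u / (1 + u) := by
      field_simp
      ring
    linarith
  calc 1 / (1 - Real.exp (-u)) ≤ 1 / (u / (1 + u)) := one_div_le_one_div_of_le (by positivity) h1r
    _ = 1 + 1 / u := by
        field_simp
        ring

/-- **Exponential sums over the cycle momenta**: for `β > 0`,
`∑_{y ∈ ℤ/Lℤ} exp(-β √(1 - cos(2πy/L))) ≤ 2 + L/β` (two geometric series). [folklore] -/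
theorem cycle_sum_exp_neg_sqrt_le {β : ℝ} (hβ : 0 < β) :
    ∑ y : ZMod L, Real.exp (-(β * Real.sqrt (1 - Real.cos (2 * π * (y.val : ℝ) / L)))) ≤
      2 + L / β := by
  have hL0 : (0 : ℝ) < L := by exact_mod_cast Nat.pos_of_ne_zero (NeZero.ne L)
  set r := Real.exp (-(2 * β / L)) with hr
  have hr0 : 0 < r := Real.exp_pos _
  have hr1 : r < 1 := Real.exp_lt_one_iff.2 (by rw [neg_lt_zero]; positivity)
  have h1 : ∑ y : ZMod L, Real.exp (-(β * Real.sqrt (1 - Real.cos (2 * π * (y.val : ℝ) / L)))) ≤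
      ∑ y : ZMod L, (r ^ y.val + r ^ (L - y.val)) :=
    sum_le_sum fun y _ => exp_neg_mul_sqrt_one_sub_cos_le hβ.le (ZMod.val_lt y)
  have h2 : ∑ y : ZMod L, (r ^ y.val + r ^ (L - y.val)) = ∑ j ∈ range L, (r ^ j + r ^ (L - j)) :=
    sum_zmod_val_eq_sum_range (fun j => r ^ j + r ^ (L - j))
  have h3 : ∑ j ∈ range L, r ^ j ≤ 1 / (1 - r) := by
    have := geom_sum_Ico_le_of_lt_one hr0.le hr1 (m := 0) (n := L)
    rwa [pow_zero, ← range_eq_Ico] at this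
  have h4 : ∑ j ∈ range L, r ^ (L - j) ≤ 1 / (1 - r) := by
    have e : ∑ j ∈ range L, r ^ (L - j) = ∑ j ∈ range L, r ^ (j + 1) := by
      rw [← Finset.sum_range_reflect (fun j => r ^ (j + 1)) L]
      refine sum_congr rfl fun j hj => ?_
      have := mem_range.1 hj
      congr 1
      omega
    rw [e]
    calc ∑ j ∈ range L, r ^ (j + 1) ≤ ∑ j ∈ range L, r ^ j :=
        sum_le_sum fun j _ => pow_le_pow_of_le_one hr0.le hr1.le (Nat.le_succ j)
      _ ≤ 1 / (1 - r) := h3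
  have h5 : 1 / (1 - r) ≤ 1 + L / β / 2 := by
    have h := one_div_one_sub_exp_neg_le (u := 2 * β / L) (by positivity)
    have e : 1 / (2 * β / (L : ℝ)) = L / β / 2 := by field_simp
    rw [e] at h
    exact h
  calc _ ≤ ∑ y : ZMod L, (r ^ y.val + r ^ (L - y.val)) := h1
    _ = ∑ j ∈ range L, (r ^ j + r ^ (L - j)) := h2
    _ = ∑ j ∈ range L, r ^ j + ∑ j ∈ range L, r ^ (L - j) := sum_add_distrib
    _ ≤ 1 / (1 - r) + 1 / (1 - r) := add_le_add h3 h4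
    _ ≤ 2 + L / β := by linarith

/-- The weighted exponential sum: for `β > 0`,
`∑_y √(1 - cos(2πy/L)) exp(-β √(1 - cos(2πy/L))) ≤ (2/β)(2 + 2L/β)` (`x e^{-βx} ≤ (2/β) e^{-βx/2}`).
[folklore] -/
theorem cycle_sum_sqrt_mul_exp_le {β : ℝ} (hβ : 0 < β) :
    ∑ y : ZMod L, Real.sqrt (1 - Real.cos (2 * π * (y.val : ℝ) / L)) *
        Real.exp (-(β * Real.sqrt (1 - Real.cos (2 * π * (y.val : ℝ) / L)))) ≤
      2 / β * (2 + 2 * L / β) := by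
  have key : ∀ x : ℝ, 0 ≤ x → x * Real.exp (-(β * x)) ≤ 2 / β * Real.exp (-(β / 2 * x)) := by
    intro x hx
    have hw : β / 2 * x * Real.exp (-(β / 2 * x)) ≤ 1 := by
      have := Real.add_one_le_exp (β / 2 * x)
      rw [Real.exp_neg, mul_inv_le_iff₀ (Real.exp_pos _)]
      linarith
    have e : x * Real.exp (-(β * x)) =
        2 / β * ((β / 2 * x * Real.exp (-(β / 2 * x))) * Real.exp (-(β / 2 * x))) := by
      rw [show -(β * x) = -(β / 2 * x) + -(β / 2 * x) by ring, Real.exp_add]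
      field_simp
    rw [e]
    exact mul_le_mul_of_nonneg_left (mul_le_of_le_one_left (Real.exp_nonneg _) hw) (by positivity)
  calc _ ≤ ∑ y : ZMod L, 2 / β * Real.exp (-(β / 2 * Real.sqrt (1 - Real.cos (2 * π * (y.val : ℝ) / L)))) :=
        sum_le_sum fun y _ => key _ (Real.sqrt_nonneg _)
    _ = 2 / β * ∑ y : ZMod L, Real.exp (-(β / 2 * Real.sqrt (1 - Real.cos (2 * π * (y.val : ℝ) / L)))) := by
        rw [mul_sum]
    _ ≤ 2 / β * (2 + L / (β / 2)) := by
        gcongr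
        exact cycle_sum_exp_neg_sqrt_le (half_pos hβ)
    _ = 2 / β * (2 + 2 * L / β) := by
        congr 2
        field_simp

/-- `1/(1 + y) ≤ exp(-y/8)` for `0 ≤ y ≤ 4` (`exp(y/8) ≤ 1/(1 - y/8) ≤ 1 + y`). [folklore] -/
theorem one_div_one_add_le_exp_neg {y : ℝ} (hy0 : 0 ≤ y) (hy4 : y ≤ 4) :
    1 / (1 + y) ≤ Real.exp (-(y / 8)) := by
  have h1 : Real.exp (y / 8) ≤ 1 / (1 - y / 8) :=
    Real.exp_bound_div_one_sub_of_interval (by positivity) (by linarith)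
  have h2 : 1 / (1 - y / 8) ≤ 1 + y := by
    rw [div_le_iff₀ (by linarith)]
    nlinarith
  rw [Real.exp_neg, one_div]
  exact inv_anti₀ (Real.exp_pos _) (h1.trans h2)

/-- `∑ aᵢ² ≤ (∑ aᵢ)²` for nonnegative reals. [folklore] -/
theorem sum_sq_le_sq_sum {ι : Type*} (s : Finset ι) {f : ι → ℝ} (hf : ∀ i ∈ s, 0 ≤ f i) :
    ∑ i ∈ s, f i ^ 2 ≤ (∑ i ∈ s, f i) ^ 2 := by
  rw [sq (∑ i ∈ s, f i), Finset.sum_mul]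
  refine Finset.sum_le_sum fun i hi => ?_
  rw [sq]
  exact mul_le_mul_of_nonneg_left (Finset.single_le_sum hf hi) (hf i hi)

/-- `M³ ≤ 3 ∑_{v < M} (v + 1)²`. [folklore] -/
theorem cube_le_three_mul_sum_sq (M : ℕ) :
    (M : ℝ) ^ 3 ≤ 3 * ∑ v ∈ range M, ((v : ℝ) + 1) ^ 2 := by
  induction M with
  | zero => simp
  | succ m ih =>
    rw [Finset.sum_range_succ]
    push_cast
    nlinarith [ih, (Nat.cast_nonneg m : (0 : ℝ) ≤ m)]

/-- `∏_{i : Fin 3} (if i = μ then A else B) = A B²`. [folklore] -/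
theorem prod_ite_eq_fin_three (μ : Fin 3) (A B : ℝ) :
    ∏ i : Fin 3, (if i = μ then A else B) = A * B ^ 2 := by
  rw [Fin.prod_univ_three]
  fin_cases μ <;> simp <;> ring

end CycleEstimates

end Literature.Probability.LatticeModels

end
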